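/-
Copyright (c) 2026. All rights reserved.
Released under Apache 2.0 license as described in the file LICENSE.
Authors: abc-iut cell, prover seat abc-iut-L4-t6 (gen 14; cell row S3 «ARC-LTIMES-CARRIER», L4-lead m184 (2): "say whether the
pinned closer is stated at `archGenuinePlus` or `…Orb` — prefer BOTH"), over this seat's `Orb`-carrier (`…ArchGenuinePlusOrb`), its
pinned file (`…ArchGenuinePlusPinned`) and abc-iut-L4-t8's `⋉`-twin of abc-iut-f-101's sufficiency theorem (`Ltimes/…Contact`).
-/
import Literature.AnabelianGeometry.AbsoluteAnabelian.Ltimes.LogFrobeniusArchGenuinePlusOrb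
import Literature.AnabelianGeometry.AbsoluteAnabelian.Ltimes.LogFrobeniusArchGenuinePlusPinned
import HarnessLib

/-!
# [AbsTopIII] Cor 5.10 (iv)(b)(c), PINNED reading, at the `Orb`-carrier: TRUE for EVERY Aut-holomorphic field functor,
# with NO hypothesis beyond `V(F_mod) ≠ ∅`

S. Mochizuki, *Topics in absolute anabelian geometry III: global reconstruction algorithms*, J. Math. Sci. Univ.
Tokyo 22 (2015) 939–1156 [MochizukiAbsTopIII2015]; locators `p.N` = pages of the author's manuscript
(`paper:url-5493eb38cbb7`): Cor 5.10 (iv)(b)(c) pp. 147–148 (the telecore `𝔗_{An⊢}`, the contact structure `ℋ_{An⊢}` generated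
by the `η⊢_{v,ν}` and the mono-analyticization homotopies), §0 p. 28 (`Orb(−)`), Def 5.6 (iv) p. 136
(`𝒩⊢⊞_w := Orb(𝒞^{hol⊢}_{TB⊞}) ×_{Orb(TM⊢),w} Th⊢[Z]`).

PROOF-ONLY sequel (cell row S3; L4-lead m184 (2) / m185 division of M1).  File 3 (`…ArchGenuinePlusPinned`) states the pinned
row at `archGenuinePlus` under abc-iut-w5-d038's orientation cochain (zero hypotheses at the geometric functor); this file
states it at the `Orb`-carrier `archGenuinePlusOrb` (file `…ArchGenuinePlusOrb`: `TB⊞`-factor coarsened by print's `Orb(−)`),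
where NO cochain is needed:

* ★★★ `LogFrobeniusSettingLtimes.archGenuinePlusOrb_cor510MonoTelecorePinned` — **for EVERY Aut-holomorphic field functor `𝔄`
  and every index with `V(F_mod) ≠ ∅`, the PINNED Cor 5.10 (iv)(b)(c) HOLDS at the `Orb`-carrier** (abc-iut-f-101's sufficiency
  theorem over `⋉`, abc-iut-L4-t8's `Ltimes/LogFrobeniusMonoTelecoreContact.lean`, applied to `archGenuinePlusOrb_monoTelecoreCoherence`);
  `…_iff` (`↔ Nonempty Vmod`); `exists_orb_cor510MonoTelecorePinned` (bookkeeping form);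
* ★★ `LogFrobeniusSettingLtimes.pinned_frozen_false_orb_true` — **for EVERY `𝔄`** over a nonempty all-archimedean index with
  `𝒞^hol_TF` nonempty: the pinned row is FALSE over the FROZEN interface at abc-iut-w6-d025's arc chart (file 3's
  `not_cor510MonoTelecorePinned_archGenuineMonoAnChart`) and TRUE over the `⋉`-successor at the `Orb`-carrier — no cochain on
  either side;
* ★★ `HolRS.RC.orb_pinned_where_uncoarsened_eta_empty` — at abc-iut-L4-t2's `RC`-model with the complex plane: no un-coarsened
  `η⊢_{v,pre}` exists (abc-iut-w5-d038), yet the pinned (iv)(b)(c) holds at the `Orb`-carrier.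

HONEST SCOPE: as files 1–3 and `…Orb` ((L2) nonarchimedean places of this arc carrier are stand-ins — the two-sided `⋉`-carrier
is abc-iut-L4-t8's `genuineTwoSidedSumLtimes`, L4-lead m185; (L3′) `A_N` = the `Lie±`-sign automorphisms, orbit relation as the
generated congruence; (L-N⊢), (L4)).  MODEL-LEVEL; a carrier of OUR successor typing, print unchanged; refereed pre-IUT material;
nothing here bears on [IUTchIII] Cor. 3.12; no side taken; instantiated ≠ endorsed; typed ≠ proved.
-/

set_option autoImplicit false

universe u

open CategoryTheory

namespace Literature.AnabelianGeometry.AbsoluteAnabelian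

namespace LogFrobeniusSettingLtimes

variable (𝔄 : AutHolFieldFunctor.{u}) (Vmod : Type (u + 1)) (isArc : Vmod → Bool)

/-- ★★★ **[AbsTopIII] Cor 5.10 (iv)(b)(c), PINNED reading, HOLDS at the `Orb`-carrier for EVERY Aut-holomorphic field functor,
every index `(Vmod, isArc)` with `V(F_mod) ≠ ∅`, NO further hypothesis**: the mono-analytic telecore `𝔗_{An⊢}` (edges the genuine
`ψArc` read in `Orb(TB⊞)`) and a contact structure `ℋ_{An⊢}` compatible with `𝒥` containing the pinned pairs `(γ¹_{v,ν}, γ⁰_{v,ν})`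
exist there — abc-iut-f-101's sufficiency theorem over `⋉` fed with `archGenuinePlusOrb_monoTelecoreCoherence`.
[cite: MochizukiAbsTopIII2015, Cor 5.10 (iv)(b)(c) pp. 147–148] -/
theorem archGenuinePlusOrb_cor510MonoTelecorePinned [Nonempty Vmod] :
    (archGenuinePlusOrb 𝔄 Vmod isArc).Cor510MonoTelecorePinned :=
  (archGenuinePlusOrb_monoTelecoreCoherence 𝔄 Vmod isArc).cor510MonoTelecorePinned

/-- **The pinned row at the `Orb`-carrier, EXACTLY**: it holds iff `V(F_mod) ≠ ∅`.
[cite: MochizukiAbsTopIII2015, Cor 5.10 (iv)(b)(c) pp. 147–148] -/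
theorem archGenuinePlusOrb_cor510MonoTelecorePinned_iff :
    (archGenuinePlusOrb 𝔄 Vmod isArc).Cor510MonoTelecorePinned ↔ Nonempty Vmod :=
  (archGenuinePlusOrb_monoTelecoreCoherence 𝔄 Vmod isArc).cor510MonoTelecorePinned_iff

/-- Bookkeeping form (node AbsTopIII:Cor5.10(iv), M1, `Orb` variant): for EVERY `𝔄` and every index with `V(F_mod) ≠ ∅`, a
`⋉`-carrier on abc-iut-L4-t2's `𝒞^hol_TF` with genuine `𝒞^hol_{TH⊞}` `⊞`-side and `𝒩⊢⊞_w = TM⊢ × Orb(TB⊞)`, carrying both add-ons,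
at which Cor 5.10 (iv)(a) AND the pinned (iv)(b)(c) hold — no cochain, no class restriction.
[cite: MochizukiAbsTopIII2015, Cor 5.10 (iv) pp. 146–148] -/
theorem exists_orb_cor510MonoTelecorePinned [Nonempty Vmod] :
    ∃ (Lt : LogFrobeniusSettingLtimes Vmod isArc) (M : Lt.MonoAnalyticizationHomotopies),
      Nonempty (Lt.MonoTelecoreCoherence M) ∧ Lt.X = Up (HolTFPair 𝔄) ∧ (∀ v, Lt.Nplus v = Up (HolTHPlusPair 𝔄)) ∧
        (∀ w, Lt.NmonoPlus w = (TMMono.{u + 1} × TBPlus.Orb.{u + 1})) ∧ Lt.Cor510MonoCores ∧ Lt.Cor510MonoTelecorePinned :=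
  ⟨archGenuinePlusOrb 𝔄 Vmod isArc, archGenuinePlusOrb_monoAnalyticizationHomotopies 𝔄 Vmod isArc,
    ⟨archGenuinePlusOrb_monoTelecoreCoherence 𝔄 Vmod isArc⟩, rfl, fun _ => rfl, fun _ => rfl,
    archGenuinePlusOrb_cor510MonoCores 𝔄 Vmod isArc, archGenuinePlusOrb_cor510MonoTelecorePinned 𝔄 Vmod isArc⟩

/-- ★★ **For EVERY Aut-holomorphic field functor, no cochain on either side**: over a nonempty all-archimedean index with
`𝒞^hol_TF` nonempty, the PINNED Cor 5.10 (iv)(b)(c) is FALSE over the FROZEN interface at abc-iut-w6-d025's arc chart (file 3,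
N1 at the node row) and TRUE over the `⋉`-successor at the `Orb`-carrier.
[cite: MochizukiAbsTopIII2015, Cor 5.10 (iv)(c) p. 148] -/
theorem pinned_frozen_false_orb_true (Vmod : Type (u + 1)) [Nonempty Vmod] [Nonempty (HolTFPair 𝔄)] :
    ¬ (LogFrobeniusSetting.archGenuineMonoAnChart 𝔄 Vmod (fun _ => true)).Cor510MonoTelecorePinned ∧
      (archGenuinePlusOrb 𝔄 Vmod (fun _ => true)).Cor510MonoTelecorePinned :=
  ⟨LogFrobeniusSetting.not_cor510MonoTelecorePinned_archGenuineMonoAnChart 𝔄 Vmod,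
    archGenuinePlusOrb_cor510MonoTelecorePinned 𝔄 Vmod (fun _ => true)⟩

end LogFrobeniusSettingLtimes

namespace HolRS.RC

/-- ★★ **At abc-iut-L4-t2's `RC`-model** (geometric Aut-holomorphic field functor with complex conjugations, any class `Q`
containing the complex plane), every index with `V(F_mod) ≠ ∅`: NO un-coarsened archimedean `η⊢_{v,pre}` exists
(abc-iut-w5-d038's `isEmpty_etaTilde_iso_of_complexPlane`) — yet the PINNED Cor 5.10 (iv)(b)(c) HOLDS at the `Orb`-carrier over
the same functor. [cite: MochizukiAbsTopIII2015, Cor 5.10 (iv)(c) p. 148] -/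
theorem orb_pinned_where_uncoarsened_eta_empty (Q : ObjectProperty RC) (hQ : Q ⟨complexPlane⟩) (Vmod : Type 1)
    [Nonempty Vmod] (isArc : Vmod → Bool) :
    IsEmpty (HolTFPair.lamSimPlus (geometricAutHolFieldFunctorRC Q) ⋙ HolTHPlusPair.toTBPlus _ ⋙
        TBPlus.uliftFunctor.{1} ≅ HolTFPair.toEA _ ⋙ (geometricAutHolFieldFunctorRC Q).toTMMono ⋙ TMMono.kTilde) ∧
      (LogFrobeniusSettingLtimes.archGenuinePlusOrb (geometricAutHolFieldFunctorRC Q) Vmod isArc).Cor510MonoTelecorePinned :=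
  ⟨isEmpty_etaTilde_iso_of_complexPlane Q hQ,
    LogFrobeniusSettingLtimes.archGenuinePlusOrb_cor510MonoTelecorePinned _ Vmod isArc⟩

end HolRS.RC

end Literature.AnabelianGeometry.AbsoluteAnabelian
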